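import Literature.Geometry.Lorentzian.CoordUhlenbeckFrame
import Mathlib.Topology.MetricSpace.Thickening
import HarnessLib

/-!
# Parallel frames along geodesics in coordinates: first and second derivatives of the curvature components

Coordinate tensor calculus (the `MetricCoord` layer) for the spatial half of the proof of
Hamilton's maximum principle for the curvature ODE
(`Literature.Geometry.Riemannian.hamilton_maximumPrinciple_curvatureODE`; Hamilton 1986, §4,
Thm. 4.3). Hamilton 1986, §4, proof of Lemma 4.2 / Thm. 4.3 (p. 162): at a point where the
distance of the section `M` from the convex set is largest one compares along **geodesics with
parallel frames**, along which the components of a tensor have first derivative the components of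
`∇M` and second derivative the components of `∇²M`, whose trace over an orthonormal frame is the
rough Laplacian `ΔM`. For metric components `G` on an open set `V` and curves
`γ, u : ℝ → E`, `W : ℝ → (ι → E)` solving the **geodesic / parallel-transport system**
`γ' = u`, `u' = −Γ_γ(u,u)`, `W'_i = −Γ_γ(u, W_i)` (O'Neill 1983, Ch. 3, Def. 3.18 ff. and
Prop. 3.13 on coordinate fields):

* `geoField G` — the vector field of the system on `E × E × (ι → E)` and its smoothness
  (`IsMetricOn.contDiffOn_geoField`);
* `IsMetricOn.hasDerivAt_pairing_parallel` — `G_γ(W_i, W_j)` is constant (parallel transport is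
  isometric; O'Neill 1983, Ch. 3, Lemma 3.20);
* `IsMetricOn.hasDerivAt_rmComp_parallel` — **first derivative**:
  `d/ds Rm_γ(W_a,W_b,W_c,W_d) = G_γ((∇_u R)(W_a,W_b)W_c, W_d)` (`covRiemAt`);
* `IsMetricOn.hasDerivAt_covForm_parallel` — **second derivative**:
  `d/ds G_γ((∇_u R)(W_a,W_b)W_c, W_d) = G_γ((∇²_{u,u} R)(W_a,W_b)W_c, W_d)` (`cov2RiemAt`), using
  the geodesic equation;
* `IsMetricOn.continuousOn_cov2Form` — joint continuity of
  `(y, u, W) ↦ G_y((∇²_{u,u}R)(W_a,W_b)W_c, W_d)` on `{y ∈ V}` (for the uniform modulus of the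
  second derivative along the compact family of frames);
* `IsMetricOn.exists_geodesicFrames` — solutions of the system through a compact family of
  initial data with uniform existence time, confinement and speed (Picard–Lindelöf via the tree's
  `Literature.Analysis.ODE.exists_flow_mem_closedBall`).

All derivatives are computed on the bundled expressions (`riemCLM`, `fderiv (riemCLM G)`,
`chrAt`, `IsMetricOn.covRiemAt_eq_riemCLM`, `IsMetricOn.fderiv_covRiemAt`) by the product rule.
Everything is proved; no definition of `Prop` type is introduced.

## References

* R. S. Hamilton, *Four-manifolds with positive curvature operator*, J. Differential Geom. 24
  (1986) 153–179, §4, Lemma 4.2 and Thm. 4.3 (p. 162). [Hamilton1986]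
* B. O'Neill, *Semi-Riemannian geometry*, Academic Press 1983, Ch. 3: Prop. 3.13, Def. 3.18,
  Lemma 3.20, Prop. 3.37, and p. 76 (`∇R`, `∇²R` on coordinate fields). [ONeill1983]
* P. Topping, *Lectures on the Ricci flow*, LMS Lecture Note Series 325, CUP 2006, §2.1
  (`Δ = tr ∇²`). [Topping2006]
-/

noncomputable section

set_option maxSynthPendingDepth 5

open Set Filter Metric ContinuousLinearMap Module
open scoped Topology ContDiff NNReal

namespace Literature.Geometry.Lorentzian

namespace MetricCoord

variable {E : Type*} [NormedAddCommGroup E] [NormedSpace ℝ E] [CompleteSpace E]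

/-! ### The geodesic / parallel-transport system -/

section Field

variable {ι : Type*} (G : E → E →L[ℝ] E →L[ℝ] ℝ)

/-- The **geodesic / parallel-transport field** on `E × E × (ι → E)`:
`(y, u, W) ↦ (u, −Γ_y(u,u), (−Γ_y(u, W_i))_i)` — its integral curves are a geodesic `γ` with
velocity `u = γ'` together with a parallel frame `W` along it (O'Neill 1983, Ch. 3, Def. 3.18 and
Prop. 3.13: `(D_{γ'} W)^k = W^k' + Γ^k_{ij} γ'^i W^j`). [cite: ONeill1983, Ch. 3, Def. 3.18] -/
def geoField (q : E × E × (ι → E)) : E × E × (ι → E) :=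
  (q.2.1, -chrAt G q.1 q.2.1 q.2.1, fun i ↦ -chrAt G q.1 q.2.1 (q.2.2 i))

omit [CompleteSpace E] in
/-- Unfolding lemma for `geoField`. [folklore] -/
theorem geoField_apply (q : E × E × (ι → E)) :
    geoField G q = (q.2.1, -chrAt G q.1 q.2.1 q.2.1, fun i ↦ -chrAt G q.1 q.2.1 (q.2.2 i)) := rfl

variable {G} {V : Set E}

/-- The field is `C^∞` on `{(y, u, W) : y ∈ V}`. [folklore] -/
theorem IsMetricOn.contDiffOn_geoField [Fintype ι] (hG : IsMetricOn G V) :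
    ContDiffOn ℝ ∞ (geoField (ι := ι) G) {q | q.1 ∈ V} := by
  have hΓ : ContDiffOn ℝ ∞ (fun q : E × E × (ι → E) ↦ chrAt G q.1) {q | q.1 ∈ V} :=
    hG.contDiffOn_chrAt.comp contDiff_fst.contDiffOn fun q hq ↦ hq
  have hu : ContDiffOn ℝ ∞ (fun q : E × E × (ι → E) ↦ q.2.1) {q | q.1 ∈ V} :=
    (contDiff_fst.comp contDiff_snd).contDiffOn
  have hΓu := hΓ.clm_apply hu
  refine hu.prodMk ((hΓu.clm_apply hu).neg.prodMk ?_)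
  refine contDiffOn_pi.2 fun i ↦ (hΓu.clm_apply ?_).neg
  exact ((ContinuousLinearMap.proj i : (ι → E) →L[ℝ] E).contDiff.comp
    (contDiff_snd.comp contDiff_snd)).contDiffOn

end Field

/-! ### Algebra: the first-derivative identity -/

section Static

variable {G : E → E →L[ℝ] E →L[ℝ] ℝ} {V : Set E} {y : E}

/-- **The derivative of `Rm` along a parallel frame, pointwise algebra**: the six terms of the
product rule for `d/ds G_γ(R_γ(W_a,W_b)W_c, W_d)` (with `γ' = u`, `W' = −Γ(u, W)` and
`∂_u G(P,Q) = G(Γ(u,P),Q) + G(P,Γ(u,Q))`) add up to `G((∇_u R)(W_a,W_b)W_c, W_d)`.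
[cite: ONeill1983, Ch. 3, Prop. 3.37] -/
theorem IsMetricOn.deriv_rmForm_identity (hG : IsMetricOn G V) (hy : y ∈ V) (u X Y Z U : E) :
    fderiv ℝ G y u (riemCLM G y X Y Z) U + G y (fderiv ℝ (riemCLM G) y u X Y Z) U
      - G y (riemCLM G y (chrAt G y u X) Y Z) U - G y (riemCLM G y X (chrAt G y u Y) Z) U
      - G y (riemCLM G y X Y (chrAt G y u Z)) U - G y (riemCLM G y X Y Z) (chrAt G y u U) =
    G y (covRiemAt G y u X Y Z) U := by
  rw [hG.fderiv_eq_chrAt hy, hG.covRiemAt_eq_riemCLM hy]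
  simp only [map_add, map_sub, _root_.add_apply, _root_.sub_apply, ContinuousLinearMap.comp_apply]
  abel

end Static

/-! ### Derivatives along the geodesic / parallel-transport system -/

section Dynamic

variable {ι : Type*} {G : E → E →L[ℝ] E →L[ℝ] ℝ} {V : Set E} {γ u : ℝ → E} {W : ℝ → ι → E}
  {s : ℝ}

omit [CompleteSpace E] in
/-- **Parallel transport is isometric**: along the system, `G_γ(W_i, W_j)` has derivative `0`
(O'Neill 1983, Ch. 3, Lemma 3.20: `d/ds ⟨W_i, W_j⟩ = ⟨W'_i, W_j⟩ + ⟨W_i, W'_j⟩ = 0`).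
[cite: ONeill1983, Ch. 3, Lemma 3.20] -/
theorem IsMetricOn.hasDerivAt_pairing_parallel (hG : IsMetricOn G V) (hγV : γ s ∈ V)
    (hγ : HasDerivAt γ (u s) s)
    (hW : ∀ i, HasDerivAt (fun σ ↦ W σ i) (-chrAt G (γ s) (u s) (W s i)) s) (i j : ι) :
    HasDerivAt (fun σ ↦ G (γ σ) (W σ i) (W σ j)) 0 s := by
  have hGγ : HasDerivAt (fun σ ↦ G (γ σ)) (fderiv ℝ G (γ s) (u s)) s :=
    (hG.differentiableAt hγV).hasFDerivAt.comp_hasDerivAt s hγ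
  have h := (hGγ.clm_apply (hW i)).clm_apply (hW j)
  refine h.congr_deriv ?_
  simp only [map_neg, _root_.add_apply, _root_.neg_apply, hG.fderiv_eq_chrAt hγV]
  abel

omit [CompleteSpace E] in
/-- Pairings of the velocity with frame vectors are constant as well:
`d/ds G_γ(u, W_j) = 0` (the velocity of a geodesic is parallel). [cite: ONeill1983, Ch. 3, Lemma 3.20] -/
theorem IsMetricOn.hasDerivAt_pairing_velocity (hG : IsMetricOn G V) (hγV : γ s ∈ V)
    (hγ : HasDerivAt γ (u s) s) (hu : HasDerivAt u (-chrAt G (γ s) (u s) (u s)) s)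
    (hW : ∀ i, HasDerivAt (fun σ ↦ W σ i) (-chrAt G (γ s) (u s) (W s i)) s) (j : ι) :
    HasDerivAt (fun σ ↦ G (γ σ) (u σ) (W σ j)) 0 s := by
  have hGγ : HasDerivAt (fun σ ↦ G (γ σ)) (fderiv ℝ G (γ s) (u s)) s :=
    (hG.differentiableAt hγV).hasFDerivAt.comp_hasDerivAt s hγ
  have h := (hGγ.clm_apply hu).clm_apply (hW j)
  refine h.congr_deriv ?_
  simp only [map_neg, _root_.add_apply, _root_.neg_apply, hG.fderiv_eq_chrAt hγV]
  abel

omit [CompleteSpace E] in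
/-- `d/ds G_γ(u, u) = 0` (geodesics have constant speed). [cite: ONeill1983, Ch. 3, Lemma 3.20] -/
theorem IsMetricOn.hasDerivAt_pairing_velocity_self (hG : IsMetricOn G V) (hγV : γ s ∈ V)
    (hγ : HasDerivAt γ (u s) s) (hu : HasDerivAt u (-chrAt G (γ s) (u s) (u s)) s) :
    HasDerivAt (fun σ ↦ G (γ σ) (u σ) (u σ)) 0 s := by
  have hGγ : HasDerivAt (fun σ ↦ G (γ σ)) (fderiv ℝ G (γ s) (u s)) s :=
    (hG.differentiableAt hγV).hasFDerivAt.comp_hasDerivAt s hγ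
  have h := (hGγ.clm_apply hu).clm_apply hu
  refine h.congr_deriv ?_
  simp only [map_neg, _root_.add_apply, _root_.neg_apply, hG.fderiv_eq_chrAt hγV]
  abel

/-- **First derivative of the curvature components along a parallel frame**:
`d/ds Rm_γ(W_a,W_b,W_c,W_d) = G_γ((∇_{γ'} R)(W_a,W_b)W_c, W_d)` (O'Neill 1983, Ch. 3, p. 76:
`(D_u R)(X,Y)V = D_u(R(X,Y)V) − R(D_uX,Y)V − R(X,D_uY)V − R(X,Y)D_uV`, with all `D_u W = 0`).
[cite: ONeill1983, Ch. 3, Prop. 3.37] -/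
theorem IsMetricOn.hasDerivAt_rmComp_parallel (hG : IsMetricOn G V) (hγV : γ s ∈ V)
    (hγ : HasDerivAt γ (u s) s)
    (hW : ∀ i, HasDerivAt (fun σ ↦ W σ i) (-chrAt G (γ s) (u s) (W s i)) s) (a b c d : ι) :
    HasDerivAt (fun σ ↦ rmComp G (γ σ) (W σ) a b c d)
      (G (γ s) (covRiemAt G (γ s) (u s) (W s a) (W s b) (W s c)) (W s d)) s := by
  have hGγ : HasDerivAt (fun σ ↦ G (γ σ)) (fderiv ℝ G (γ s) (u s)) s :=
    (hG.differentiableAt hγV).hasFDerivAt.comp_hasDerivAt s hγ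
  have hRγ : HasDerivAt (fun σ ↦ riemCLM G (γ σ)) (fderiv ℝ (riemCLM G) (γ s) (u s)) s :=
    (hG.differentiableAt_riemCLM hγV).hasFDerivAt.comp_hasDerivAt s hγ
  have h := (hGγ.clm_apply (((hRγ.clm_apply (hW a)).clm_apply (hW b)).clm_apply (hW c))).clm_apply (hW d)
  have hfun : (fun σ ↦ rmComp G (γ σ) (W σ) a b c d) =
      fun σ ↦ G (γ σ) (riemCLM G (γ σ) (W σ a) (W σ b) (W σ c)) (W σ d) := by
    funext σ; rw [rmComp_apply, riemCLM_apply]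
  rw [hfun]
  refine h.congr_deriv ?_
  rw [← hG.deriv_rmForm_identity hγV]
  simp only [map_add, map_neg, _root_.add_apply, _root_.neg_apply]
  abel

/-- **Second derivative of the curvature components along a geodesic with parallel frame**:
`d/ds G_γ((∇_u R)(W_a,W_b)W_c, W_d) = G_γ((∇²_{u,u} R)(W_a,W_b)W_c, W_d)` where `u = γ'` solves the
geodesic equation `u' = −Γ(u,u)` (`∇²_{X,U} = ∇_X∇_U − ∇_{∇_X U}`; Topping 2006, §2.1, with
`cov2RiemAt`). Product rule on the bundled expression of `∇R` (`covRiemAt_eq_riemCLM`) compared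
with `fderiv_covRiemAt` and `cov2RiemAt_def`. [cite: Hamilton1986, §4, p. 162] -/
theorem IsMetricOn.hasDerivAt_covForm_parallel (hG : IsMetricOn G V) (hγV : γ s ∈ V)
    (hγ : HasDerivAt γ (u s) s) (hu : HasDerivAt u (-chrAt G (γ s) (u s) (u s)) s)
    (hW : ∀ i, HasDerivAt (fun σ ↦ W σ i) (-chrAt G (γ s) (u s) (W s i)) s) (a b c d : ι) :
    HasDerivAt (fun σ ↦ G (γ σ) (covRiemAt G (γ σ) (u σ) (W σ a) (W σ b) (W σ c)) (W σ d))
      (G (γ s) (cov2RiemAt G (γ s) (u s) (u s) (W s a) (W s b) (W s c)) (W s d)) s := by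
  -- smooth bundled pieces along the curve
  have hGγ : HasDerivAt (fun σ ↦ G (γ σ)) (fderiv ℝ G (γ s) (u s)) s :=
    (hG.differentiableAt hγV).hasFDerivAt.comp_hasDerivAt s hγ
  have hRγ : HasDerivAt (fun σ ↦ riemCLM G (γ σ)) (fderiv ℝ (riemCLM G) (γ s) (u s)) s :=
    (hG.differentiableAt_riemCLM hγV).hasFDerivAt.comp_hasDerivAt s hγ
  have hD0 : HasFDerivAt (fderiv ℝ (riemCLM G)) (fderiv ℝ (fderiv ℝ (riemCLM G)) (γ s)) (γ s) :=
    (hG.differentiableAt_fderiv_riemCLM hγV).hasFDerivAt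
  have hDγ : HasDerivAt (fun σ ↦ fderiv ℝ (riemCLM G) (γ σ))
      (fderiv ℝ (fderiv ℝ (riemCLM G)) (γ s) (u s)) s :=
    hD0.comp_hasDerivAt s hγ
  have hΓγ : HasDerivAt (fun σ ↦ chrAt G (γ σ)) (fderiv ℝ (chrAt G) (γ s) (u s)) s :=
    (hG.differentiableAt_chrAt hγV).hasFDerivAt.comp_hasDerivAt s hγ
  -- the bundled expression of `∇R` along the curve
  have hDuab := ((hDγ.clm_apply hu).clm_apply (hW a)).clm_apply (hW b)
  have hΓu := hΓγ.clm_apply hu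
  have hRab := (hRγ.clm_apply (hW a)).clm_apply (hW b)
  have h2 := hΓu.clm_comp hRab
  have h3 := hRab.clm_comp hΓu
  have h4 := (hRγ.clm_apply (hΓu.clm_apply (hW a))).clm_apply (hW b)
  have h5 := (hRγ.clm_apply (hW a)).clm_apply (hΓu.clm_apply (hW b))
  have hinner := (((hDuab.fun_add h2).fun_sub h3).fun_sub h4).fun_sub h5
  have htot := (hGγ.clm_apply (hinner.clm_apply (hW c))).clm_apply (hW d)
  -- the function agrees with the bundled expression near `s`
  have hγc : ContinuousAt γ s := hγ.continuousAt
  have hev : ∀ᶠ σ in 𝓝 s, γ σ ∈ V := hγc.preimage_mem_nhds (hG.mem_nhds hγV)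
  have heq : (fun σ ↦ G (γ σ) (covRiemAt G (γ σ) (u σ) (W σ a) (W σ b) (W σ c)) (W σ d)) =ᶠ[𝓝 s]
      fun σ ↦ G (γ σ) ((fderiv ℝ (riemCLM G) (γ σ) (u σ) (W σ a) (W σ b)
        + (chrAt G (γ σ) (u σ)).comp (riemCLM G (γ σ) (W σ a) (W σ b))
        - (riemCLM G (γ σ) (W σ a) (W σ b)).comp (chrAt G (γ σ) (u σ))
        - riemCLM G (γ σ) (chrAt G (γ σ) (u σ) (W σ a)) (W σ b)
        - riemCLM G (γ σ) (W σ a) (chrAt G (γ σ) (u σ) (W σ b))) (W σ c)) (W σ d) :=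
    hev.mono fun σ hσ ↦ by simp only [hG.covRiemAt_eq_riemCLM hσ]
  refine (htot.congr_of_eventuallyEq heq).congr_deriv ?_
  -- algebra: compare with `cov2RiemAt_def` + `fderiv_covRiemAt` + `covRiemAt_eq_riemCLM`
  rw [cov2RiemAt_def]
  simp only [_root_.add_apply, _root_.sub_apply, hG.fderiv_covRiemAt hγV]
  simp only [hG.covRiemAt_eq_riemCLM hγV, hG.fderiv_eq_chrAt hγV, map_add, map_sub, map_neg,
    _root_.add_apply, _root_.sub_apply, _root_.neg_apply, ContinuousLinearMap.comp_apply]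
  abel

end Dynamic

/-! ### Joint continuity of the second covariant derivative of the curvature on frames -/

section Continuity

variable {ι : Type*} {G : E → E →L[ℝ] E →L[ℝ] ℝ} {V : Set E}

/-- **Joint continuity of `(y, u, W) ↦ G_y((∇²_{u,u} R)(W_a,W_b)W_c, W_d)`** on `{y ∈ V}`: the
expression is polynomial in `(u, W)` with coefficients the continuous (indeed `C^∞`) bundled fields
`G`, `Γ`, `DΓ`, `R`, `DR`, `D²R` of `y` (`cov2RiemAt_def`, `fderiv_covRiemAt`,
`covRiemAt_eq_riemCLM`). [cite: ONeill1983, Ch. 3, Prop. 3.37] -/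
theorem IsMetricOn.continuousOn_cov2Form (hG : IsMetricOn G V) (a b c d : ι) :
    ContinuousOn (fun q : E × E × (ι → E) ↦
      G q.1 (cov2RiemAt G q.1 q.2.1 q.2.1 (q.2.2 a) (q.2.2 b) (q.2.2 c)) (q.2.2 d)) {q | q.1 ∈ V} := by
  -- continuous building blocks on `{q.1 ∈ V}`
  set T : Set (E × E × (ι → E)) := {q | q.1 ∈ V} with hT
  have hfst : ∀ q ∈ T, q.1 ∈ V := fun q hq ↦ hq
  have hGc : ContinuousOn (fun q : E × E × (ι → E) ↦ G q.1) T :=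
    hG.contDiffOn.continuousOn.comp continuous_fst.continuousOn hfst
  have hΓc : ContinuousOn (fun q : E × E × (ι → E) ↦ chrAt G q.1) T :=
    hG.contDiffOn_chrAt.continuousOn.comp continuous_fst.continuousOn hfst
  have hDΓc : ContinuousOn (fun q : E × E × (ι → E) ↦ fderiv ℝ (chrAt G) q.1) T :=
    (hG.contDiffOn_chrAt.continuousOn_fderiv_of_isOpen hG.isOpen (by simp)).comp
      continuous_fst.continuousOn hfst
  have hRc : ContinuousOn (fun q : E × E × (ι → E) ↦ riemCLM G q.1) T :=
    hG.contDiffOn_riemCLM.continuousOn.comp continuous_fst.continuousOn hfst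
  have hDR : ContDiffOn ℝ ∞ (fderiv ℝ (riemCLM G)) V :=
    hG.contDiffOn_riemCLM.fderiv_of_isOpen hG.isOpen (by simp)
  have hDRc : ContinuousOn (fun q : E × E × (ι → E) ↦ fderiv ℝ (riemCLM G) q.1) T :=
    hDR.continuousOn.comp continuous_fst.continuousOn hfst
  have hDDRc : ContinuousOn (fun q : E × E × (ι → E) ↦ fderiv ℝ (fderiv ℝ (riemCLM G)) q.1) T :=
    (hDR.continuousOn_fderiv_of_isOpen hG.isOpen (by simp)).comp continuous_fst.continuousOn hfst
  have huc : ContinuousOn (fun q : E × E × (ι → E) ↦ q.2.1) T := continuous_snd.fst.continuousOn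
  have hWc : ∀ i, ContinuousOn (fun q : E × E × (ι → E) ↦ q.2.2 i) T := fun i ↦
    ((continuous_apply i).comp continuous_snd.snd).continuousOn
  -- the explicit expression
  have hΓu := hΓc.clm_apply huc
  have hDΓuu := (hDΓc.clm_apply huc).clm_apply huc
  have hRab := (hRc.clm_apply (hWc a)).clm_apply (hWc b)
  have hDRuab := ((hDRc.clm_apply huc).clm_apply (hWc a)).clm_apply (hWc b)
  -- `∇_v R (X, Y)` bundled, for continuous `v, X, Y`
  have hcovG : ∀ {v X Y : E × E × (ι → E) → E}, ContinuousOn v T → ContinuousOn X T →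
      ContinuousOn Y T → ContinuousOn (fun q : E × E × (ι → E) ↦
        fderiv ℝ (riemCLM G) q.1 (v q) (X q) (Y q)
          + (chrAt G q.1 (v q)).comp (riemCLM G q.1 (X q) (Y q))
          - (riemCLM G q.1 (X q) (Y q)).comp (chrAt G q.1 (v q))
          - riemCLM G q.1 (chrAt G q.1 (v q) (X q)) (Y q)
          - riemCLM G q.1 (X q) (chrAt G q.1 (v q) (Y q))) T := by
    intro v X Y hv hX hY
    have hΓv := hΓc.clm_apply hv
    have hRXY := (hRc.clm_apply hX).clm_apply hY
    exact ((((((hDRc.clm_apply hv).clm_apply hX).clm_apply hY).fun_add (hΓv.clm_comp hRXY)).fun_sub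
      (hRXY.clm_comp hΓv)).fun_sub ((hRc.clm_apply (hΓv.clm_apply hX)).clm_apply hY)).fun_sub
      ((hRc.clm_apply hX).clm_apply (hΓv.clm_apply hY))
  have hcov := hcovG huc (hWc a) (hWc b)
  -- `∂_u (∇_u R)(a,b)` from `fderiv_covRiemAt`
  have hDRu := hDRc.clm_apply huc
  have hD1 := ((((((((((hDDRc.clm_apply huc).clm_apply huc).clm_apply (hWc a)).clm_apply (hWc b)).fun_add
      (hDΓuu.clm_comp hRab)).fun_add (hΓu.clm_comp hDRuab)).fun_sub (hDRuab.clm_comp hΓu)).fun_sub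
      (hRab.clm_comp hDΓuu)).fun_sub ((hDRu.clm_apply (hΓu.clm_apply (hWc a))).clm_apply (hWc b))).fun_sub
      ((hRc.clm_apply (hDΓuu.clm_apply (hWc a))).clm_apply (hWc b))).fun_sub
      ((hDRu.clm_apply (hWc a)).clm_apply (hΓu.clm_apply (hWc b)))
  have hD1' := hD1.fun_sub ((hRc.clm_apply (hWc a)).clm_apply (hDΓuu.clm_apply (hWc b)))
  -- assemble `∇²_{u,u}R(a,b)` bundled
  have hcovΓuu := hcovG (hΓu.clm_apply huc) (hWc a) (hWc b)
  have hcovuΓa := hcovG huc (hΓu.clm_apply (hWc a)) (hWc b)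
  have hcovuΓb := hcovG huc (hWc a) (hΓu.clm_apply (hWc b))
  have hfull := ((((hD1'.fun_add (hΓu.clm_comp hcov)).fun_sub (hcov.clm_comp hΓu)).fun_sub hcovΓuu).fun_sub
    hcovuΓa).fun_sub hcovuΓb
  have hscalar := (hGc.clm_apply (hfull.clm_apply (hWc c))).clm_apply (hWc d)
  refine hscalar.congr fun q hq ↦ ?_
  have hy : q.1 ∈ V := hq
  simp only
  rw [cov2RiemAt_def]
  simp only [_root_.add_apply, _root_.sub_apply, hG.fderiv_covRiemAt hy]
  simp only [hG.covRiemAt_eq_riemCLM hy, map_add, map_sub, _root_.add_apply, _root_.sub_apply,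
    ContinuousLinearMap.comp_apply]

end Continuity

/-! ### Solutions of the system with uniform constants over a compact set of initial data -/

section Existence

variable {ι : Type*} [Fintype ι] [FiniteDimensional ℝ E] {G : E → E →L[ℝ] E →L[ℝ] ℝ} {V K : Set E}

/-- **Geodesics with parallel frames through a compact family of initial data, with uniform
existence time, confinement and speed.** For metric components on the open set `V` and a compact
`K ⊆ V`, there are `ε > 0`, `L ≥ 0` and `ρ > 0` with the closed `ρ`-neighbourhood of `K` inside
`V` such that every initial datum `(y, u₀, W₀)` with `y ∈ K`, `‖u₀‖ ≤ R`, `‖W₀‖ ≤ R` is the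
initial value of a solution `q = (γ, u, W)` of `γ' = u`, `u' = −Γ(u,u)`, `W' = −Γ(u,W)` on
`[−ε, ε]` staying in a fixed compact set `D` of states with base points in `V` and with
`‖q(s) − q(0)‖ ≤ L|s|` (Picard–Lindelöf on a compact neighbourhood, where the smooth field is
bounded and Lipschitz). O'Neill 1983, Ch. 3, Lemma 3.19 ff.
(existence of geodesics and of parallel translation). [cite: ONeill1983, Ch. 3, Def. 3.18] -/
theorem IsMetricOn.exists_geodesicFrames (hG : IsMetricOn G V) (hK : IsCompact K) (hKV : K ⊆ V)
    (R : ℝ) :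
    ∃ ε > 0, ∃ L ≥ 0, ∃ D : Set (E × E × (ι → E)), IsCompact D ∧ D ⊆ {q | q.1 ∈ V} ∧
      ∀ p : E × E × (ι → E), p.1 ∈ K → ‖p.2.1‖ ≤ R → ‖p.2.2‖ ≤ R →
        ∃ q : ℝ → E × E × (ι → E), q 0 = p ∧
          (∀ s ∈ Icc (-ε) ε, HasDerivWithinAt q (geoField G (q s)) (Icc (-ε) ε) s) ∧
          (∀ s ∈ Icc (-ε) ε, q s ∈ D) ∧ ∀ s ∈ Icc (-ε) ε, ‖q s - p‖ ≤ L * |s| := by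
  -- a closed neighbourhood of `K` inside `V`
  obtain ⟨ρ, hρ, hρV⟩ := hK.exists_cthickening_subset_open hG.isOpen hKV
  -- the compact set of states reached
  set D : Set (E × E × (ι → E)) :=
    (cthickening ρ K) ×ˢ ((closedBall (0 : E) (|R| + ρ)) ×ˢ (closedBall (0 : ι → E) (|R| + ρ))) with hD
  have hDc : IsCompact D :=
    hK.cthickening.prod ((isCompact_closedBall _ _).prod (isCompact_closedBall _ _))
  have hDV : D ⊆ {q : E × E × (ι → E) | q.1 ∈ V} := fun q hq ↦ hρV hq.1
  have hopen : IsOpen {q : E × E × (ι → E) | q.1 ∈ V} := hG.isOpen.preimage continuous_fst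
  have hΦ := hG.contDiffOn_geoField (ι := ι)
  -- bounds for the field and its derivative on `D`
  obtain ⟨L₀, hL₀⟩ := hDc.exists_bound_of_continuousOn (hΦ.continuousOn.mono hDV)
  obtain ⟨K₀, hK₀⟩ := hDc.exists_bound_of_continuousOn
    ((hΦ.continuousOn_fderiv_of_isOpen hopen (by simp)).mono hDV)
  set L : ℝ := |L₀| + 1 with hL
  have hLpos : 0 < L := by positivity
  have hL₀L : ∀ q ∈ D, ‖geoField G q‖ ≤ L := fun q hq ↦
    (hL₀ q hq).trans ((le_abs_self L₀).trans (by linarith))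
  -- balls around admissible initial data lie in `D`
  have hball : ∀ p : E × E × (ι → E), p.1 ∈ K → ‖p.2.1‖ ≤ R → ‖p.2.2‖ ≤ R →
      closedBall p ρ ⊆ D := by
    intro p hp1 hp2 hp3 q hq
    rw [mem_closedBall, dist_eq_norm] at hq
    have h1 : ‖q.1 - p.1‖ ≤ ρ := (norm_fst_le (q - p)).trans hq
    have h2 : ‖q.2.1 - p.2.1‖ ≤ ρ := ((norm_fst_le (q - p).2).trans (norm_snd_le (q - p))).trans hq
    have h3 : ‖q.2.2 - p.2.2‖ ≤ ρ := ((norm_snd_le (q - p).2).trans (norm_snd_le (q - p))).trans hq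
    refine ⟨?_, ?_, ?_⟩
    · exact mem_cthickening_of_dist_le q.1 p.1 ρ K hp1 (by rwa [dist_eq_norm])
    · rw [mem_closedBall, dist_zero_right]
      calc ‖q.2.1‖ = ‖(q.2.1 - p.2.1) + p.2.1‖ := by rw [sub_add_cancel]
        _ ≤ ‖q.2.1 - p.2.1‖ + ‖p.2.1‖ := norm_add_le _ _
        _ ≤ ρ + |R| := add_le_add h2 (hp2.trans (le_abs_self R))
        _ = |R| + ρ := add_comm _ _
    · rw [mem_closedBall, dist_zero_right]
      calc ‖q.2.2‖ = ‖(q.2.2 - p.2.2) + p.2.2‖ := by rw [sub_add_cancel]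
        _ ≤ ‖q.2.2 - p.2.2‖ + ‖p.2.2‖ := norm_add_le _ _
        _ ≤ ρ + |R| := add_le_add h3 (hp3.trans (le_abs_self R))
        _ = |R| + ρ := add_comm _ _
  -- the existence time
  set ε : ℝ := ρ / L with hε
  have hεpos : 0 < ε := div_pos hρ hLpos
  refine ⟨ε, hεpos, L, hLpos.le, D, hDc, hDV, fun p hp1 hp2 hp3 ↦ ?_⟩
  have hsub := hball p hp1 hp2 hp3
  -- Picard–Lindelöf on `closedBall p ρ`
  set aB : ℝ≥0 := ⟨ρ, hρ.le⟩ with haB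
  set LB : ℝ≥0 := ⟨L, hLpos.le⟩ with hLB
  set KB : ℝ≥0 := ⟨|K₀|, abs_nonneg _⟩ with hKB
  have ht₀ : (0 : ℝ) ∈ Icc (-ε) ε := ⟨by linarith, hεpos.le⟩
  have hlip : LipschitzOnWith KB (geoField (ι := ι) G) (closedBall p ρ) := by
    refine (convex_closedBall p ρ).lipschitzOnWith_of_nnnorm_fderiv_le (𝕜 := ℝ) (fun q hq ↦ ?_)
      fun q hq ↦ ?_
    · exact (hΦ.contDiffAt (hopen.mem_nhds (hDV (hsub hq)))).differentiableAt (by simp)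
    · have h := hK₀ q (hsub hq)
      change ‖fderiv ℝ (geoField G) q‖ ≤ |K₀|
      exact h.trans (le_abs_self _)
  have hPL : IsPicardLindelof (fun _ : ℝ ↦ geoField (ι := ι) G) (⟨0, ht₀⟩ : Icc (-ε) ε) p aB 0 LB KB := by
    refine IsPicardLindelof.of_time_independent (fun q hq ↦ hL₀L q (hsub hq)) hlip ?_
    show L * max (ε - 0) (0 - -ε) ≤ (aB : ℝ) - ((0 : ℝ≥0) : ℝ)
    rw [NNReal.coe_zero, sub_zero, sub_zero, zero_sub, neg_neg, max_self, hε,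
      mul_div_cancel₀ _ hLpos.ne']
    exact le_rfl
  obtain ⟨flow, hflow⟩ := Literature.Analysis.ODE.exists_flow_mem_closedBall hPL
  obtain ⟨h0, hd, hb⟩ := hflow p (mem_closedBall_self le_rfl)
  refine ⟨flow p, h0, hd, fun s _ ↦ hsub (hb s), fun s hs ↦ ?_⟩
  · -- speed bound from the confinement and `‖geoField‖ ≤ L` on `D`
    have hmem : ∀ σ ∈ Icc (-ε) ε, flow p σ ∈ D := fun σ _ ↦ hsub (hb σ)
    rcases le_total 0 s with hs0 | hs0
    · have hI : Icc 0 s ⊆ Icc (-ε) ε := Icc_subset_Icc (by linarith) hs.2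
      have key := norm_image_sub_le_of_norm_deriv_le_segment' (f := flow p)
        (f' := fun σ ↦ geoField G (flow p σ)) (fun σ hσ ↦ (hd σ (hI hσ)).mono hI)
        (fun σ hσ ↦ hL₀L _ (hmem σ (hI (Ico_subset_Icc_self hσ)))) s (right_mem_Icc.2 hs0)
      rw [h0, sub_zero] at key
      rwa [abs_of_nonneg hs0]
    · have hI : Icc s 0 ⊆ Icc (-ε) ε := Icc_subset_Icc hs.1 (by linarith)
      have key := norm_image_sub_le_of_norm_deriv_le_segment' (f := flow p)
        (f' := fun σ ↦ geoField G (flow p σ)) (fun σ hσ ↦ (hd σ (hI hσ)).mono hI)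
        (fun σ hσ ↦ hL₀L _ (hmem σ (hI (Ico_subset_Icc_self hσ)))) 0 (right_mem_Icc.2 hs0)
      rw [h0] at key
      rw [abs_of_nonpos hs0, ← norm_neg, neg_sub]
      simpa using key

end Existence

end MetricCoord

end Literature.Geometry.Lorentzian

end
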